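import Summits.QuantumFields.YangMills.Theorems.BalabanUVNodesN12FarDatumSurgeryPrelim
import Summits.QuantumFields.YangMills.Theorems.BalabanUVNodesN12DirectSurjSharpDelta2
import Summits.QuantumFields.YangMills.Theorems.BalabanUVNodesN12FlatLinAvgOntoPins
import HarnessLib

/-!
# DAG node N12 [B15] — FAR-DATUM SURGERY: the (2.12) minimisers at `𝐁_k(Z)` do not read the `k`-datum off `Z^{(k)}`

Cell `pub-ymgap` (HUMAN RULINGS D-0062 ∕ D-0149), width seat `pub-ymgap-dag-n12-w6` g18.  Key K1⁹ `stmt-QuantumFields-27364`, `--kind proof --supports … --as helper`;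
count-neutral; THEOREMS ONLY (0 `def`, 0 `instance`, 0 `sorry`).

WHY (cell bus 2026-08-29, ⚑ LOCATED-DATUM-FAR).  The (σ)_N letter of record `N12GaugeLetterLocExplicit.exists_gaugeLetterLoc_atRecord_explicit` asks its region datum `W` to be
`ρn`-flat on a bond set `𝒞` containing the `k`-shadow of EVERY face-crossing member of `𝐁_k(Z)` — at level `0` these are all fine bonds meeting `Ω₁(Z)ᶜ ⊇ Zᶜ` ([III] (2.2)
`Γ₀ = Ω₁ᶜ`), so `𝒞` reaches arbitrarily far off `Z`, where the knit's datum `ext V_k = V_k` is a bare large-field variable.  THIS FILE proves that the variational problem does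
not care: if two `k`-data `W, W′` agree on the `k`-bonds INSIDE `Z^{(k)}`, the SURGERED configuration (`U₀` on the fine bonds with both ends in `Z`, the pulled-back datum
`Q_k^{s*}W′` elsewhere) is a (2.12) minimiser for `M˙(Q_k^{s*}W′)` whenever `U₀` is one for `M˙(Q_k^{s*}W)` — so the (σ)_N producer may be run at the LOCALISED datum
(`W′ := W` on `Z^{(k)}`, `1` off it; next file `…N12GaugeLetterLocExplicitOnZ`).

[Balaban1988Convergent] = «[III]», (2.2) p. 255 (`Γ₀ = Ω₁ᶜ`), (2.10)–(2.13) pp. 256–257, (1.3) p. 246; [Balaban1985Variational] = «[15]», (2)–(4) p. 278; [Balaban1985RegularSpaces] (1.7),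
(1.9) p. 77; [Balaban1987RG1] (0.2) p. 252, (0.4) p. 253.

CONTENTS (namespace `Summit.QuantumFields.YangMills.BalabanUVNodes.N12FarDatumSurgery`).
* (§1 collar bookkeeping and §2 the class locality `mem_regMSCoPOfRecord_of_eqOn_inside` are the preliminaries file `…N12FarDatumSurgeryPrelim`, consumed by name.)
* §3 the (2.10) data: the surgered configuration carries the data of `Q_k^{s*}W′` (`agreeOn_surgery`), by `Bj_zero` at level `0` and two-block locality above.
* §4 ★★★ `isMinimizer_surgery_far` + `exists_surgery`.

HONEST FRAMING.  Lattice bookkeeping + one plaquette-wise action identity; nothing of Bałaban's estimates asserted or refuted; count-neutral helper; N12 NOT discharged; K1⁹ NOT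
closed; counts unmoved; one finite 𝕋⁴ programme at fixed ε — R4 closes the conditional rung `BalabanLadder.UV` only; NOT continuum ∕ OS ∕ mass gap ∕ Clay.
-/

noncomputable section

open scoped BigOperators

namespace Summit.QuantumFields.YangMills.BalabanUVNodes.N12FarDatumSurgery

open Set
open Literature.MathematicalPhysics.QuantumFieldTheory.Balaban1983to89
open T4Continuum GaugeField B15DeterminingSets BlockAveraging
open B14.Eq213MaximalDomains (side)
open B14.Eq213DetSet (Bj Bj_zero Bj_mid Bj_top maxDomT maxDomT_zero maxDomT_subset maxDomT_antitone dist_maxDomT isBlockUnion_maxDomT)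
open B14.Eq22Determines (blockIter IsBlockUnion)
open B14DomainGeom (Pt Within)
open B15Eq112TorusCover (cover lift cover_lift cover_apply)
open B15Claim189CubePin (cover_add_single)
open B10StarCount (shift_unshift unshift_shift)
open B14SeparationOfRecord (mem_hullD_iff)
open B5Eq118OneStroke (iterBlockOf)
open B8Eq17ClassAkV1 (plaqsOf mem_plaqsOf)
open Literature.MathematicalPhysics.QuantumFieldTheory.BalabanImbrieJaffe1984to88.BIJ85Eq453GaugeField (qsstarGIter0)
open B14.Eq216Concrete (qsstarGIter0_eq)
open Summit.QuantumFields.YangMills.BalabanUVNodes.N12DirectSurjSharpDelta2 (avgFamily_congr_sharp)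
open Summit.QuantumFields.YangMills.BalabanUVNodes.N12FlatLinAvgOntoPins (mem_maxDomT_of_adjacent)
open Summit.QuantumFields.YangMills.BalabanUVNodes.N12BjCollarRoots (mem_maxDomT_of_iterBlockOf_mem_Bj)

variable {P : Params}

open Summit.QuantumFields.YangMills.BalabanUVNodes.N12FarDatumSurgeryPrelim

/-! ## §3  The (2.10) data of the surgered configuration -/

section Data

variable {F : T4Family} {N : ℕ} [NeZero N] {Kt k : ℕ} {ν : Node00.Stage7Numerics} {Z : Set (Site (F.P Kt) 0)}

/-- The pulled-back datum `Q_k^{s*}W` on a fine bond with both ends in the `k`-block union `Z` reads `W` only inside `Z^{(k)}` ((1.3) with `k`-blocks: the value is `1` inside a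
block and `W⟨B^k b₋, μ(b)⟩` across a face — both blocks in `Z^{(k)}`). [cite: Balaban1988Convergent, (1.3) p.246, (2.16) p.257, (2.1) p.255] -/
theorem qsstarGIter0_congr_inside {G : Type*} [GaugeGroup G] (hk : k ≤ (F.P Kt).m + (F.P Kt).K) (hZblk : IsBlockUnion k Z)
    {W W' : GaugeField (F.P Kt) k G} (hWW' : ∀ e : PBond (F.P Kt) k, e.src ∈ pts k Z → e.tgt ∈ pts k Z → W' e = W e)
    {b : PBond (F.P Kt) 0} (hs : b.src ∈ Z) (ht : b.tgt ∈ Z) : qsstarGIter0 k W' b = qsstarGIter0 k W b := by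
  rw [qsstarGIter0_eq k hk, qsstarGIter0_eq k hk]
  by_cases hc : blockIter k b.tgt = blockIter k b.src
  · rw [if_pos hc, if_pos hc]
  · rw [if_neg hc, if_neg hc]
    have htgt : blockIter k b.tgt = (blockIter k b.src).shift b.dir := (B14.Eq216Concrete.blockIter_shift k hk b.src b.dir).resolve_left hc
    refine hWW' _ (mem_pts.2 ((hZblk b.src).1 hs)) ?_
    show (blockIter k b.src).shift b.dir ∈ pts k Z
    rw [← htgt]
    exact mem_pts.2 ((hZblk b.tgt).1 ht)

/-- **THE TWO BLOCKS OF A MEMBER LIE IN `Z`** ([III] (2.13) collar): for a member `c` of `𝐁_k(Z)` at a level `1 ≤ j ≤ k`, every fine point of the `j`-blocks `B^j(c₋)`, `B^j(c₊)` lies in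
`Ω_{j−1}(Z) ⊆ Z` (the constrained end is a `Γ_j`-point over `Ω_j`, the other block is its lattice neighbour — `mem_maxDomT_of_adjacent`, `M₁ ≥ 2`).
[cite: Balaban1988Convergent, (2.2) p.255, (2.13) pp.256–257] -/
theorem mem_of_iterBlockOf_eq_member (hM2 : 2 ≤ ν.M₁) (hk : k ≤ (F.P Kt).m + (F.P Kt).K) (hdiv : side (F.P Kt).L ν.M₁ k ∣ (F.P Kt).sitesPerDir 0)
    {j : ℕ} (hj1 : 1 ≤ j) (hjk : j ≤ k) {c : PBond (F.P Kt) j} (hc : c ∈ bondsOf ((Bj ν.M₁ Z k : DetSet (F.P Kt)) j))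
    {q : Site (F.P Kt) 0} (hq : iterBlockOf j q = c.src ∨ iterBlockOf j q = c.tgt) : q ∈ Z := by
  have hM : 1 ≤ ν.M₁ := by omega
  obtain ⟨i, rfl⟩ : ∃ i, j = i + 1 := ⟨j - 1, by omega⟩
  -- `Γ_j ⊆ Ω_j^{(j)}` at the positive scales
  have hΓ : ∀ {y : Site (F.P Kt) (i + 1)}, y ∈ (Bj ν.M₁ Z k : DetSet (F.P Kt)) (i + 1) → embIter (i + 1) y ∈ maxDomT ν.M₁ Z (i + 1) := fun {y} hy => by
    rcases hjk.lt_or_eq with hlt | heq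
    · rw [Bj_mid hj1 hlt] at hy; exact mem_pts.1 hy.1
    · subst heq; rw [Bj_top] at hy; exact mem_pts.1 hy
  -- the block of the constrained end lies in `Ω_{i+1} ⊆ Z`; the neighbouring block lies in `Ω_i ⊆ Z`
  have hown : ∀ {y : Site (F.P Kt) (i + 1)}, y ∈ (Bj ν.M₁ Z k : DetSet (F.P Kt)) (i + 1) → iterBlockOf (i + 1) q = y → q ∈ Z := fun hy hqy =>
    maxDomT_subset hM Z _ (mem_maxDomT_of_iterBlockOf_mem_Bj hM hdiv hk hj1 (hqy ▸ hy))
  have hnb : ∀ (y : Site (F.P Kt) (i + 1)) (μ : Fin (F.P Kt).d),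
      (embIter (i + 1) (y.shift μ) ∈ maxDomT ν.M₁ Z (i + 1) ∨ embIter (i + 1) (y.unshift μ) ∈ maxDomT ν.M₁ Z (i + 1)) → iterBlockOf (i + 1) q = y → q ∈ Z :=
    fun y μ hadj hqy => maxDomT_subset hM Z _ (mem_maxDomT_of_adjacent hM2 hdiv hjk (hjk.trans hk) y μ hadj q hqy)
  rcases hc with hsrc | htgt
  · rcases hq with h | h
    · exact hown hsrc h
    · exact hnb c.tgt c.dir (Or.inr (by rw [show c.tgt.unshift c.dir = c.src from unshift_shift _ _]; exact hΓ hsrc)) h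
  · rcases hq with h | h
    · exact hnb c.src c.dir (Or.inl (hΓ htgt)) h
    · exact hown htgt h

/-- **THE (2.10) DATA OF A SURGERED CONFIGURATION.**  If `U₀` carries the data of `Q_k^{s*}W` on `𝐁_k(Z)` and `U′ = U₀` on the fine bonds with both ends in `Z`, `U′ = Q_k^{s*}W′` elsewhere
(`W′ = W` inside `Z^{(k)}`), then `U′` carries the data of `Q_k^{s*}W′`: at level `0` the members are the bonds meeting `Ω₁ᶜ` (`Bj_zero`), pinned to the datum; above, a member's
average reads only its two blocks, inside `Z` (`avgFamily_congr_sharp`). [cite: Balaban1988Convergent, (2.2) p.255, (2.10)–(2.11) p.256, (2.13) pp.256–257] -/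
theorem agreeOn_surgery (hM2 : 2 ≤ ν.M₁) (hk : k ≤ (F.P Kt).m + (F.P Kt).K) (hdiv : side (F.P Kt).L ν.M₁ k ∣ (F.P Kt).sitesPerDir 0) (hZblk : IsBlockUnion k Z)
    {W W' : GaugeField (F.P Kt) k (Node00.SU N)} (hWW' : ∀ e : PBond (F.P Kt) k, e.src ∈ pts k Z → e.tgt ∈ pts k Z → W' e = W e)
    {U₀ U' : GaugeField (F.P Kt) 0 (Node00.SU N)} (hdata : AgreeOn (Bj ν.M₁ Z k) (avgFamily (Node00.avOfRecord F N Kt) U₀) (avgFamily (Node00.avOfRecord F N Kt) (qsstarGIter0 k W)))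
    (hin : ∀ b : PBond (F.P Kt) 0, b.src ∈ Z → b.tgt ∈ Z → U' b = U₀ b)
    (hout : ∀ b : PBond (F.P Kt) 0, ¬ (b.src ∈ Z ∧ b.tgt ∈ Z) → U' b = qsstarGIter0 k W' b) :
    AgreeOn (Bj ν.M₁ Z k) (avgFamily (Node00.avOfRecord F N Kt) U') (avgFamily (Node00.avOfRecord F N Kt) (qsstarGIter0 k W')) := by
  intro j c hc
  rcases Nat.eq_zero_or_pos j with rfl | hj
  · -- level 0: the bond itself
    show U' c = qsstarGIter0 k W' c
    by_cases hcin : c.src ∈ Z ∧ c.tgt ∈ Z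
    · have h0 : U₀ c = qsstarGIter0 k W c := hdata 0 c hc
      rw [hin c hcin.1 hcin.2, h0, qsstarGIter0_congr_inside hk hZblk hWW' hcin.1 hcin.2]
    · exact hout c hcin
  · have hjk : j ≤ k := by
      by_contra h
      rw [B14.Eq213DetSet.Bj_of_gt (not_le.mp h)] at hc
      simp [bondsOf] at hc
    have hjK : j ≤ (F.P Kt).m + (F.P Kt).K := hjk.trans hk
    have h1 : avgFamily (Node00.avOfRecord F N Kt) U' j c = avgFamily (Node00.avOfRecord F N Kt) U₀ j c :=
      avgFamily_congr_sharp hjK c fun b₀ hs ht =>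
        hin b₀ (mem_of_iterBlockOf_eq_member hM2 hk hdiv hj hjk hc hs) (mem_of_iterBlockOf_eq_member hM2 hk hdiv hj hjk hc ht)
    have h2 : avgFamily (Node00.avOfRecord F N Kt) (qsstarGIter0 k W) j c = avgFamily (Node00.avOfRecord F N Kt) (qsstarGIter0 k W') j c :=
      avgFamily_congr_sharp hjK c fun b₀ hs ht =>
        (qsstarGIter0_congr_inside hk hZblk hWW' (mem_of_iterBlockOf_eq_member hM2 hk hdiv hj hjk hc hs)
          (mem_of_iterBlockOf_eq_member hM2 hk hdiv hj hjk hc ht)).symm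
    rw [h1, hdata j c hc, h2]

end Data

/-! ## §4  The surgered configuration is a (2.12) minimiser for the surgered datum -/

section Surgery

variable {F : T4Family} {N : ℕ} [NeZero N] {Kt k : ℕ} {ν : Node00.Stage7Numerics} {Z : Set (Site (F.P Kt) 0)}

/-- The Wilson action difference is decided plaquette by plaquette: if on every plaquette either `(A, B)` and `(C, D)` have the same variables pairwise or `A = B` and `C = D` there, then
`A(A) − A(B) = A(C) − A(D)`. [cite: Balaban1987RG1, (0.2) p.252] -/
theorem wilsonAction4_sub_eq {j : ℕ} {G : Type*} [GaugeGroup G] {A B C D : GaugeField (F.P Kt) j G}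
    (h : ∀ p : Plaq (F.P Kt) j, (plaqHol A p = plaqHol C p ∧ plaqHol B p = plaqHol D p) ∨ (plaqHol A p = plaqHol B p ∧ plaqHol C p = plaqHol D p)) :
    wilsonAction4 A - wilsonAction4 B = wilsonAction4 C - wilsonAction4 D := by
  unfold wilsonAction4 wilsonAction
  rw [← Finset.sum_sub_distrib, ← Finset.sum_sub_distrib]
  refine Finset.sum_congr rfl fun p _ => ?_
  rcases h p with ⟨h1, h2⟩ | ⟨h1, h2⟩
  · rw [h1, h2]
  · rw [h1, h2]; ring

/-- A bond of a plaquette with a corner off `Z` is a LEVEL-0 MEMBER of `𝐁_k(Z)` (it meets `Ω₁(Z)ᶜ`): were its source in `Ω₁`, all four corners — within three unit steps — would lie in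
`Z` (`3 ≤ L·M₁ − 1`). [cite: Balaban1988Convergent, (2.2) p.255 (`Γ₀ = Ω₁ᶜ`), (2.13) pp.256–257] -/
theorem mem_bondsOf_zero_of_corner_not_mem (hM4 : 4 ≤ ν.M₁) (hk1 : 1 ≤ k) (hdiv : side (F.P Kt).L ν.M₁ k ∣ (F.P Kt).sitesPerDir 0)
    {p : Plaq (F.P Kt) 0} (hc : ¬ (p.src ∈ Z ∧ p.src.shift p.μ ∈ Z ∧ p.src.shift p.ν ∈ Z ∧ (p.src.shift p.μ).shift p.ν ∈ Z))
    {b : PBond (F.P Kt) 0} (hb : b ∈ B14.Eq12InteriorLocality.plaqBonds p) : b ∈ bondsOf ((Bj ν.M₁ Z k : DetSet (F.P Kt)) 0) := by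
  have hM : 1 ≤ ν.M₁ := le_trans (by norm_num) hM4
  have hm := margin_le (F := F) (Kt := Kt) hM4
  rw [Bj_zero hk1]
  refine Or.inl fun hsrc => hc ?_
  -- `p.src` is within one backward step of `b.src ∈ Ω₁`
  have hp : ∃ z₁ z : Pt (F.P Kt).d, cover (F.P Kt) z₁ ∈ maxDomT ν.M₁ Z 1 ∧ cover (F.P Kt) z = p.src ∧ Within (0 + 1) z₁ z := by
    have h0 := near_of_mem_maxDomT (Z := Z) hM le_rfl hsrc
    rcases (B14.Eq12InteriorLocality.mem_plaqBonds).1 hb with rfl | rfl | rfl | rfl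
    · exact near_mono (by norm_num) h0
    · have := near_unshift h0 p.μ
      rwa [show (p.src.shift p.μ).unshift p.μ = p.src from unshift_shift _ _] at this
    · have := near_unshift h0 p.ν
      rwa [show (p.src.shift p.ν).unshift p.ν = p.src from unshift_shift _ _] at this
    · exact near_mono (by norm_num) h0
  exact ⟨mem_of_near hM hk1 hdiv (by linarith) hp, mem_of_near hM hk1 hdiv (by linarith) (near_shift hp p.μ),
    mem_of_near hM hk1 hdiv (by linarith) (near_shift hp p.ν), mem_of_near hM hk1 hdiv (by linarith) (near_shift (near_shift hp p.μ) p.ν)⟩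

/-- A surgered configuration exists (classical case split on «both ends in `Z`»). [folklore] -/
theorem exists_surgery {G : Type*} (U₀ D : GaugeField (F.P Kt) 0 G) :
    ∃ U' : GaugeField (F.P Kt) 0 G, (∀ b : PBond (F.P Kt) 0, b.src ∈ Z → b.tgt ∈ Z → U' b = U₀ b) ∧
      (∀ b : PBond (F.P Kt) 0, ¬ (b.src ∈ Z ∧ b.tgt ∈ Z) → U' b = D b) := by
  classical
  exact ⟨fun b => if b.src ∈ Z ∧ b.tgt ∈ Z then U₀ b else D b, fun b hs ht => if_pos ⟨hs, ht⟩, fun b hb => if_neg hb⟩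

/-- ★★★ **FAR-DATUM SURGERY OF (2.12) MINIMISERS.**  At the record's objects — NODE 00's class `U_k({Ω_j(Z)}, εr)` (`regMSCoPOfRecord … (maxDomT ν.M₁ Z)`), the (2.13) determining set
`𝐁_k(Z)`, the averaging of record, `Z` a union of `k`-blocks, `L^k·M₁ ∣ 2L^{m+K}`, `M₁ ≥ 4`, `1 ≤ k ≤ m + K`: if the `k`-data `W, W′` agree on the `k`-bonds inside `Z^{(k)}` and `U₀`
is a minimiser for the data `M˙(Q_k^{s*}W)`, then every configuration `U′` with `U′ = U₀` on the fine bonds with both ends in `Z` and `U′ = Q_k^{s*}W′` elsewhere is a minimiser for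
the data `M˙(Q_k^{s*}W′)`.  (Class: §2; data: §3; minimality: a competitor `V` for `W′` is surgered back to a competitor `V♮` for `W`, and `A(U′) − A(V) = A(U₀) − A(V♮)` plaquette by
plaquette — all corners in `Z`: the free variables agree pairwise; a corner off `Z`: every bond is a level-0 member, pinned on both sides.)
[cite: Balaban1988Convergent, (2.2) p.255, (2.10)–(2.13) pp.256–257, (1.3) p.246; Balaban1985Variational, (2)–(4) p.278; Balaban1987RG1, (0.2) p.252] -/
theorem isMinimizer_surgery_far (hM4 : 4 ≤ ν.M₁) (hk1 : 1 ≤ k) (hk : k ≤ (F.P Kt).m + (F.P Kt).K) (hdiv : side (F.P Kt).L ν.M₁ k ∣ (F.P Kt).sitesPerDir 0)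
    (hZblk : IsBlockUnion k Z)
    {W W' : GaugeField (F.P Kt) k (Node00.SU N)} (hWW' : ∀ e : PBond (F.P Kt) k, e.src ∈ pts k Z → e.tgt ∈ pts k Z → W' e = W e)
    {U₀ : GaugeField (F.P Kt) 0 (Node00.SU N)}
    (hmin : IsMinimizer (Node00.avOfRecord F N Kt) (Node00.regMSCoPOfRecord F N ν Kt k (maxDomT ν.M₁ Z)) (Bj ν.M₁ Z k)
      (avgFamily (Node00.avOfRecord F N Kt) (qsstarGIter0 k W)) U₀)
    {U' : GaugeField (F.P Kt) 0 (Node00.SU N)} (hin : ∀ b : PBond (F.P Kt) 0, b.src ∈ Z → b.tgt ∈ Z → U' b = U₀ b)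
    (hout : ∀ b : PBond (F.P Kt) 0, ¬ (b.src ∈ Z ∧ b.tgt ∈ Z) → U' b = qsstarGIter0 k W' b) :
    IsMinimizer (Node00.avOfRecord F N Kt) (Node00.regMSCoPOfRecord F N ν Kt k (maxDomT ν.M₁ Z)) (Bj ν.M₁ Z k)
      (avgFamily (Node00.avOfRecord F N Kt) (qsstarGIter0 k W')) U' := by
  have hM2 : 2 ≤ ν.M₁ := le_trans (by norm_num) hM4
  have hWW'symm : ∀ e : PBond (F.P Kt) k, e.src ∈ pts k Z → e.tgt ∈ pts k Z → W e = W' e := fun e hs ht => (hWW' e hs ht).symm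
  refine ⟨mem_regMSCoPOfRecord_of_eqOn_inside hM4 hk1 hdiv hin hmin.1, agreeOn_surgery hM2 hk hdiv hZblk hWW' hmin.2.1 hin hout, fun V hV hVdata => ?_⟩
  -- surger the competitor back to the datum `W`
  obtain ⟨V', hV'in, hV'out⟩ := exists_surgery (Z := Z) V (qsstarGIter0 k W)
  have hV'reg : V' ∈ Node00.regMSCoPOfRecord F N ν Kt k (maxDomT ν.M₁ Z) := mem_regMSCoPOfRecord_of_eqOn_inside hM4 hk1 hdiv hV'in hV
  have hV'data : AgreeOn (Bj ν.M₁ Z k) (avgFamily (Node00.avOfRecord F N Kt) V') (avgFamily (Node00.avOfRecord F N Kt) (qsstarGIter0 k W)) :=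
    agreeOn_surgery hM2 hk hdiv hZblk hWW'symm hVdata hV'in hV'out
  have hle := hmin.2.2 V' hV'reg hV'data
  -- the action identity, plaquette by plaquette
  have hid : wilsonAction4 U' - wilsonAction4 V = wilsonAction4 U₀ - wilsonAction4 V' := by
    refine wilsonAction4_sub_eq fun p => ?_
    by_cases hc : p.src ∈ Z ∧ p.src.shift p.μ ∈ Z ∧ p.src.shift p.ν ∈ Z ∧ (p.src.shift p.μ).shift p.ν ∈ Z
    · exact Or.inl ⟨plaqHol_congr_of_corners (X := Z) hin p hc.1 hc.2.1 hc.2.2.1 hc.2.2.2,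
        plaqHol_congr_of_corners (X := Z) (fun b hs ht => (hV'in b hs ht).symm) p hc.1 hc.2.1 hc.2.2.1 hc.2.2.2⟩
    · -- every bond of `p` is a level-0 member: pinned to `Q_k^{s*}W` under `U₀`, to `Q_k^{s*}W′` under `V`
      have hpin : ∀ b ∈ B14.Eq12InteriorLocality.plaqBonds p, U' b = V b ∧ U₀ b = V' b := fun b hb => by
        have hb0 := mem_bondsOf_zero_of_corner_not_mem (Z := Z) hM4 hk1 hdiv hc hb
        have hU₀ : U₀ b = qsstarGIter0 k W b := hmin.2.1 0 b hb0
        have hVb : V b = qsstarGIter0 k W' b := hVdata 0 b hb0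
        by_cases hbin : b.src ∈ Z ∧ b.tgt ∈ Z
        · rw [hin b hbin.1 hbin.2, hV'in b hbin.1 hbin.2, hU₀, hVb, qsstarGIter0_congr_inside hk hZblk hWW' hbin.1 hbin.2]
          exact ⟨rfl, rfl⟩
        · rw [hout b hbin, hV'out b hbin, hU₀, hVb]
          exact ⟨rfl, rfl⟩
      exact Or.inr ⟨B14.Eq12InteriorLocality.plaqHol_congr fun b hb => (hpin b hb).1, B14.Eq12InteriorLocality.plaqHol_congr fun b hb => (hpin b hb).2⟩
  linarith

/-- ★★ **COROLLARY — A MINIMISER FOR THE LOCALISED DATUM EXISTS WHENEVER ONE EXISTS FOR THE DATUM**, and it agrees with the given one on the bonds inside `Z`.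
[cite: Balaban1988Convergent, (2.12)–(2.13) pp.256–257; Balaban1985Variational, (2)–(4) p.278] -/
theorem exists_isMinimizer_surgery_far (hM4 : 4 ≤ ν.M₁) (hk1 : 1 ≤ k) (hk : k ≤ (F.P Kt).m + (F.P Kt).K) (hdiv : side (F.P Kt).L ν.M₁ k ∣ (F.P Kt).sitesPerDir 0)
    (hZblk : IsBlockUnion k Z)
    {W W' : GaugeField (F.P Kt) k (Node00.SU N)} (hWW' : ∀ e : PBond (F.P Kt) k, e.src ∈ pts k Z → e.tgt ∈ pts k Z → W' e = W e)
    {U₀ : GaugeField (F.P Kt) 0 (Node00.SU N)}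
    (hmin : IsMinimizer (Node00.avOfRecord F N Kt) (Node00.regMSCoPOfRecord F N ν Kt k (maxDomT ν.M₁ Z)) (Bj ν.M₁ Z k)
      (avgFamily (Node00.avOfRecord F N Kt) (qsstarGIter0 k W)) U₀) :
    ∃ U' : GaugeField (F.P Kt) 0 (Node00.SU N), (∀ b : PBond (F.P Kt) 0, b.src ∈ Z → b.tgt ∈ Z → U' b = U₀ b) ∧
      IsMinimizer (Node00.avOfRecord F N Kt) (Node00.regMSCoPOfRecord F N ν Kt k (maxDomT ν.M₁ Z)) (Bj ν.M₁ Z k)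
        (avgFamily (Node00.avOfRecord F N Kt) (qsstarGIter0 k W')) U' := by
  obtain ⟨U', hin, hout⟩ := exists_surgery (Z := Z) U₀ (qsstarGIter0 k W')
  exact ⟨U', hin, isMinimizer_surgery_far hM4 hk1 hk hdiv hZblk hWW' hmin hin hout⟩

end Surgery

end Summit.QuantumFields.YangMills.BalabanUVNodes.N12FarDatumSurgery

end
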